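import Literature.Probability.Percolation.FourArmGarbanOrthogonality
import Literature.Probability.Percolation.FourArmGarbanAssembly
import Literature.Probability.Percolation.FourArmGarbanCircuitBits
import HarnessLib

/-!
# Garban's multi-scale four-arm bound from the exploration scheme: the fact modulo arm separation

Topic `Literature/Probability/Percolation`; support file for the named fact
`Garban2011_fourArm_multiscale` (`FourArmGarban.lean`; C. Garban, Appendix B of O. Schramm,
S. Smirnov, *On the scaling limits of planar percolation*, Ann. Probab. 39 (2011), Lemma B.1;
J. van den Berg, P. Nolin, Progr. Probab. 77 (2020), Lemma 8). Bond percolation on `ℤ²`,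
`p = 1/2`.

This file closes the separation-free part of Garban's proof. `GarbanExplorationData` records,
at a pair of scales `(m, n)`, the construction data of the proof of Lemma B.1 — an admissible
discrete Dobrushin domain `D` (the square `Q` with the side `∂₀Q` wired and the other three sides
dual-wired), the centres `J` of the mesoscopic squares `Q_j = c_j + B(ρ)` ("cut the concentric
`Q/3` into `r × r` squares"), the radii `a' ≤ b'` of the circuit annuli `S_j ⊆ Q_j` and the outer
radius `b` of the two-arm annuli (the arcs of `D` stay outside `c_j + B(b+1)`: "`Q_j` is at
distance `≳ R` from `∂Q`"), a bounded measurable `X` (Garban's crossing variable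
`X = 2·1_{Q crossed} - 1`) — together with exactly ONE analytic input, the field `sep`:

  `P_{1/2}(fourArmTwoClusters m n) ≤ K₂ · E[X C_j Y_j]` for every `j`,

Garban's (B.2) `P⁴(r,R) ≍ P[Q_j pivotal for X]` combined with (B.4)
`E[X C_j] ≳ P[Q_j pivotal for X]` and (B.7) `E[X C_j] = E[X C_j Y_j]` — the place where "arm
separation properties similar to ones used in [Smirnov–Werner 2001]" (Kesten 1987) enter, a
theory the tree does not have for bond percolation on `ℤ²` (van den Berg–Nolin 2020, §5.1: "we
do not see how to avoid that result in the proof of Lemma 8 for a general `m ≥ 1`").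

From such data the file BUILDS Garban's scheme (`GarbanExplorationData.toScheme`:
`C_j = circuitBit c_j a' b'` with `E[C_j] = 0`, `FourArmGarbanCircuitBits.lean`;
`Y_j = 1_{Reveals hD (pairs of Q_j)}` with `P[Y_j] ≤ π₂(ρ+2, b)`, `FourArmGarbanRevealment.lean`;
"nondiagonal terms vanish", `FourArmGarbanOrthogonality.lean`) and PROVES
`Garban2011_fourArm_multiscale_of_explorationData`: **if the data exist at every pair of scales
`n ≥ C₀ m` with uniform constants, then `Garban2011_fourArm_multiscale` holds**
(`FourArmGarbanAssembly.lean`). What remains for the unconditional discharge is (i) the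
concrete admissible square domains with the stated geometry (elementary) and (ii) the field
`sep`, i.e. Kesten's arm separation for bond percolation on `ℤ²`. No named fact is introduced.

## References

* O. Schramm, S. Smirnov (appendix by C. Garban), Ann. Probab. 39 (2011), Appendix B, proof of
  Lemma B.1, (B.2)–(B.8) [SchrammSmirnov2011].
* J. van den Berg, P. Nolin, Progr. Probab. 77 (2020), §4.3 Lemma 8, §5.1 [VandenbergNolin2020].
* H. Kesten, Scaling relations for 2D-percolation, Comm. Math. Phys. 109 (1987) (arm
  separation) [KestenScalingCMP1987].

Tree: `GarbanScheme`, `Garban2011_fourArm_multiscale_of_scheme` (`FourArmGarbanAssembly.lean`),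
`circuitBit`, `measurable_circuitBit`, `abs_circuitBit_le_one`, `determinedBy_openCircuitInAnnulusAt`,
`determinedBy_dualCircuitInAnnulusAt`, `measurableSet_openCircuitInAnnulusAt`,
`measurableSet_dualCircuitInAnnulusAt`, `real_dualCircuitInAnnulusAt_half`
(`FourArmGarbanCircuitBits.lean`), `Reveals`, `measurableSet_reveals`,
`real_reveals_le_twoArmOpenDual` (`FourArmGarbanRevealment.lean`),
`integral_indicator_reveals_mul_eq_zero` (`FourArmGarbanOrthogonality.lean`), `dualEdge`,
`dualEdge_of_not_mem`, `mem_edgeSet_zdGraph_iff`, `dualEdge_single_eq`, `box_mono`.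
-/

noncomputable section

namespace Literature.Probability.Percolation

open _root_.MeasureTheory Set LatticeModels LatticeModels.DiscreteDobrushin

/-! ### The pairs of sites of a square `c + B(ρ)` -/

/-- The pairs of sites of the square `c + B(ρ)` (the "inside" of Garban's `Q_j`: its edges, and
harmlessly also its non-edge pairs). [folklore] -/
def boxPairs (c : Site 2) (ρ : ℕ) : Set (Sym2 (Site 2)) :=
  ↑(((box 2 ρ).image (Site.shift c)).sym2)

/-- Membership in the shifted box. [folklore] -/
theorem mem_image_shift_box_iff {c x : Site 2} {k : ℕ} :
    x ∈ (box 2 k).image (Site.shift c) ↔ x - c ∈ box 2 k := by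
  rw [Finset.mem_image]
  constructor
  · rintro ⟨y, hy, rfl⟩
    simpa using hy
  · intro h
    exact ⟨x - c, h, by simp⟩

/-- Membership in `boxPairs`: both sites of the pair lie in `c + B(ρ)`. [folklore] -/
theorem mem_boxPairs_iff {c : Site 2} {ρ : ℕ} {e : Sym2 (Site 2)} :
    e ∈ boxPairs c ρ ↔ ∀ x ∈ e, x - c ∈ box 2 ρ := by
  simp only [boxPairs, Finset.mem_coe, Finset.mem_sym2_iff, mem_image_shift_box_iff]

/-- `boxPairs` is monotone in the radius. [folklore] -/
theorem boxPairs_mono (c : Site 2) {ρ ρ' : ℕ} (h : ρ ≤ ρ') : boxPairs c ρ ⊆ boxPairs c ρ' :=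
  fun _ he => mem_boxPairs_iff.2 fun x hx => box_mono 2 h (mem_boxPairs_iff.1 he x hx)

/-- **The pairs read by a circuit bit lie inside the square.** The determining set of
`circuitBit c a' b'` (pairs of `c + B(b')` and edges whose dual is such a pair) is contained in
`boxPairs c ρ` as soon as `b' + 1 ≤ ρ`. [folklore] -/
theorem circuitPairs_subset_boxPairs (c : Site 2) {b' ρ : ℕ} (h : b' + 1 ≤ ρ) :
    (↑(((box 2 b').image (Site.shift c)).sym2) ∪
        dualEdge ⁻¹' ↑(((box 2 b').image (Site.shift c)).sym2) : Set (Sym2 (Site 2))) ⊆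
      boxPairs c ρ := by
  rintro e (he | he)
  · exact boxPairs_mono c (by omega) he
  · rw [mem_preimage] at he
    have he' : dualEdge e ∈ boxPairs c b' := he
    by_cases hE : e ∈ (zdGraph 2).edgeSet
    · obtain ⟨u, i, rfl⟩ := mem_edgeSet_zdGraph_iff.1 hE
      have hij : i ≠ i + 1 := by fin_cases i <;> decide
      rw [dualEdge_single_eq hij, mem_boxPairs_iff] at he'
      have hu : u - c ∈ box 2 b' := he' u (Sym2.mem_mk_right _ _)
      rw [mem_boxPairs_iff]
      intro x hx
      rcases Sym2.mem_iff.1 hx with rfl | rfl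
      · exact box_mono 2 (by omega) hu
      · have : u + Pi.single i 1 - c ∈ box 2 (b' + 1) := by
          rw [mem_box] at hu ⊢
          intro k
          have := hu k
          simp only [Pi.sub_apply, Pi.add_apply, Pi.single_apply] at this ⊢
          push_cast
          split_ifs <;> omega
        exact box_mono 2 h this
    · rw [dualEdge_of_not_mem hE] at he'
      exact boxPairs_mono c (by omega) he'

/-! ### The construction data of Garban's proof -/

/-- **The construction data of the proof of Lemma B.1 at the scales `(m, n)`** (hypothesis
bundle). `D` is an admissible discrete Dobrushin domain (Garban's square `Q`, `∂₀Q` wired open,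
the other sides dual-wired) whose medial exploration is the interface `γ`; `J` is the set of
centres of the mesoscopic squares `Q_j = c_j + B(ρ)` with pairwise disjoint squares
(`separated`), at least `K₁ (n/m)²` of them (`card_le`); `a' ≤ b'` are the radii of the circuit
annulus `S_j = c_j + A_{a',b'}` inside `Q_j` (`b'_le`); `b ≥ ρ + 2` is the outer radius of the
two-arm annulus around `Q_j`, the discrete arcs staying outside `c_j + B(b+1)` (`arcA_far`,
`arcB_far`) and `(ρ+2)/b ≤ K₄ m/n` (`ratio_le`); `X` is a measurable function with `|X| ≤ 1`
(Garban's `X = 2·1_{Q crossed} - 1`). The single analytic field `sep` is Garban's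
(B.2)+(B.4)+(B.7): `P_{1/2}(four arms at scales (m,n)) ≤ K₂ E[X C_j Y_j]` with
`C_j = circuitBit c_j a' b'`, `Y_j = 1_{Reveals hD (boxPairs c_j ρ)}` — the arm-separation input
(Kesten 1987), NOT proved in the tree. [cite: SchrammSmirnov2011, Appendix B, proof of Lemma B.1, (B.2), (B.4), (B.7)] -/
structure GarbanExplorationData (K₁ K₂ K₄ : ℝ) (m n : ℕ) where
  /-- The discrete Dobrushin domain (Garban's square `Q` with its boundary conditions). -/
  D : DiscreteDobrushin
  /-- Admissibility of the domain (well-defined exploration). -/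
  hD : D.IsZdAdmissible
  /-- The centres of the mesoscopic squares `Q_j`. -/
  J : Finset (Site 2)
  /-- Garban's crossing variable (any measurable function bounded by `1`). -/
  X : BondConfig (Site 2) → ℝ
  /-- Half-side of the squares `Q_j = c_j + B(ρ)`. -/
  ρ : ℕ
  /-- Inner radius of the circuit annuli `S_j`. -/
  a' : ℕ
  /-- Outer radius of the circuit annuli `S_j`. -/
  b' : ℕ
  /-- Outer radius of the two-arm annuli around the squares. -/
  b : ℕ
  /-- There are at least `K₁ (n/m)²` squares. -/
  card_le : K₁ * ((n : ℝ) / m) ^ 2 ≤ (J.card : ℝ)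
  /-- `X` is measurable. -/
  measurable_X : Measurable X
  /-- `|X| ≤ 1`. -/
  abs_X_le : ∀ ω, |X ω| ≤ 1
  /-- The circuit annulus is an annulus. -/
  a'_le : a' ≤ b'
  /-- The circuit annulus (and the dual one) lies well inside the square. -/
  b'_le : b' + 2 ≤ ρ
  /-- The two-arm annulus starts outside the square. -/
  ρ_le : ρ + 2 ≤ b
  /-- The two-arm annulus has ratio `≳ n/m`. -/
  ratio_le : (((ρ + 2 : ℕ) : ℝ)) / b ≤ K₄ * m / n
  /-- The squares are pairwise disjoint. -/
  separated : ∀ j ∈ J, ∀ j' ∈ J, j ≠ j' → Disjoint (boxPairs j ρ) (boxPairs j' ρ)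
  /-- The wired arc stays far from every square. -/
  arcA_far : ∀ j ∈ J, ∀ x ∈ D.zdArcA, x - j ∉ box 2 (b + 1)
  /-- The dual-wired arc stays far from every square. -/
  arcB_far : ∀ j ∈ J, ∀ x ∈ D.zdArcB, x - j ∉ box 2 (b + 1)
  /-- **(B.2)+(B.4)+(B.7), the arm-separation input**: `P⁴(m,n) ≤ K₂ E[X C_j Y_j]`. -/
  sep : ∀ j ∈ J, (bondPercolation (zdGraph 2) half).real (fourArmTwoClusters m n) ≤
    K₂ * ∫ ω in Reveals hD (boxPairs j ρ), X ω * circuitBit j a' b' ω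
      ∂(bondPercolation (zdGraph 2) half)

namespace GarbanExplorationData

variable {K₁ K₂ K₄ : ℝ} {m n : ℕ}

/-- The determining set of the circuit bit of the square at `c`. [folklore] -/
theorem circuitPairs_subset (d : GarbanExplorationData K₁ K₂ K₄ m n) (c : Site 2) :
    (↑(((box 2 d.b').image (Site.shift c)).sym2) ∪
        dualEdge ⁻¹' ↑(((box 2 d.b').image (Site.shift c)).sym2) : Set (Sym2 (Site 2))) ⊆
      boxPairs c d.ρ :=
  circuitPairs_subset_boxPairs c (by have := d.b'_le; omega)

/-- **"Nondiagonal terms vanish" for the data**: the revealed circuit bits of two distinct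
squares are orthogonal. [cite: SchrammSmirnov2011, Appendix B, proof of Lemma B.1 (nondiagonal terms)] -/
theorem orthogonal (d : GarbanExplorationData K₁ K₂ K₄ m n) {i j : Site 2} (hi : i ∈ d.J)
    (hj : j ∈ d.J) (hij : i ≠ j) :
    ∫ ω, (Reveals d.hD (boxPairs i d.ρ)).indicator (circuitBit i d.a' d.b') ω *
        (Reveals d.hD (boxPairs j d.ρ)).indicator (circuitBit j d.a' d.b') ω
      ∂(bondPercolation (zdGraph 2) half) = 0 := by
  have hE := d.separated i hi j hj hij
  have hFi := d.circuitPairs_subset i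
  have hFj := d.circuitPairs_subset j
  exact integral_indicator_reveals_mul_eq_zero d.hD half hE (hE.mono hFi hFj)
    (fun _ he _ => hFi he) (fun _ he _ => hFj he)
    ((determinedBy_openCircuitInAnnulusAt i d.a' d.b').mono subset_union_left)
    ((determinedBy_dualCircuitInAnnulusAt i d.a' d.b').mono subset_union_right)
    ((determinedBy_openCircuitInAnnulusAt j d.a' d.b').mono subset_union_left)
    ((determinedBy_dualCircuitInAnnulusAt j d.a' d.b').mono subset_union_right)
    (measurableSet_openCircuitInAnnulusAt i d.a' d.b') (measurableSet_dualCircuitInAnnulusAt i d.a' d.b')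
    (measurableSet_openCircuitInAnnulusAt j d.a' d.b') (measurableSet_dualCircuitInAnnulusAt j d.a' d.b')
    (real_dualCircuitInAnnulusAt_half i d.a' d.b').symm (real_dualCircuitInAnnulusAt_half j d.a' d.b').symm

/-- **(B.6) for the data**: the revealment probability of a square is at most the two-arm
probability `π₂(ρ+2, b)`. [cite: SchrammSmirnov2011, Appendix B, proof of Lemma B.1, (B.6)] -/
theorem reveal (d : GarbanExplorationData K₁ K₂ K₄ m n) {j : Site 2} (hj : j ∈ d.J) :
    (bondPercolation (zdGraph 2) half).real (Reveals d.hD (boxPairs j d.ρ)) ≤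
      (bondPercolation (zdGraph 2) half).real (twoArmOpenDual (d.ρ + 2) d.b) :=
  real_reveals_le_twoArmOpenDual d.hD half (k := d.ρ) le_rfl d.ρ_le
    (fun _ he x hx => mem_boxPairs_iff.1 he x hx) (d.arcA_far j hj) (d.arcB_far j hj)

/-- `E[X²] ≤ 1` for `|X| ≤ 1`. [folklore] -/
theorem integral_sq_X_le (d : GarbanExplorationData K₁ K₂ K₄ m n) :
    ∫ ω, d.X ω ^ 2 ∂(bondPercolation (zdGraph 2) half) ≤ 1 := by
  calc ∫ ω, d.X ω ^ 2 ∂(bondPercolation (zdGraph 2) half)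
      ≤ ∫ _, (1 : ℝ) ∂(bondPercolation (zdGraph 2) half) :=
        integral_mono_of_nonneg (ae_of_all _ fun ω => sq_nonneg _) (integrable_const 1)
          (ae_of_all _ fun ω => by
            have h := d.abs_X_le ω
            show d.X ω ^ 2 ≤ 1
            rw [← sq_abs]
            nlinarith [abs_nonneg (d.X ω)])
    _ = 1 := by simp

/-- **Garban's scheme from the construction data** (with `K₃ = 1`): circuit bits
`C_j = circuitBit c_j a' b'`, revealment events `V_j = Reveals hD (boxPairs c_j ρ)`, two-arm
radii `(ρ + 2, b)`. [cite: SchrammSmirnov2011, Appendix B, proof of Lemma B.1] -/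
def toScheme (d : GarbanExplorationData K₁ K₂ K₄ m n) : GarbanScheme K₁ K₂ 1 K₄ m n where
  J := d.J
  X := d.X
  C := fun j => circuitBit j d.a' d.b'
  V := fun j => Reveals d.hD (boxPairs j d.ρ)
  a := d.ρ + 2
  b := d.b
  card_le := d.card_le
  memLp_X := MemLp.of_bound d.measurable_X.aestronglyMeasurable 1
    (ae_of_all _ fun ω => by simpa [Real.norm_eq_abs] using d.abs_X_le ω)
  integral_sq_X_le := d.integral_sq_X_le
  aestronglyMeasurable_C := fun j _ => (measurable_circuitBit j d.a' d.b').aestronglyMeasurable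
  abs_C_le := fun j _ ω => abs_circuitBit_le_one j d.a' d.b' ω
  measurableSet_V := fun j _ => measurableSet_reveals d.hD _
  orthogonal := fun i hi j hj hij => d.orthogonal hi hj hij
  sep := d.sep
  one_le_a := by omega
  a_le_b := d.ρ_le
  ratio_le := d.ratio_le
  reveal := fun j hj => by rw [one_mul]; exact d.reveal hj

end GarbanExplorationData

/-- **Garban's lemma modulo arm separation and the square domains.** If at every pair of scales
`n ≥ C₀ m` (`m ≥ 1`) the construction data of the proof of Lemma B.1 exist with uniform
constants `K₁ > 0`, `K₂, K₄ ≥ 0` — admissible square domains with separated mesoscopic squares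
far from the arcs, and the arm-separation input `sep` — then `Garban2011_fourArm_multiscale`
holds. Proof: `GarbanExplorationData.toScheme` and `Garban2011_fourArm_multiscale_of_scheme`.
[cite: SchrammSmirnov2011, Appendix B, Lemma B.1 (proof structure)] -/
theorem Garban2011_fourArm_multiscale_of_explorationData {K₁ K₂ K₄ : ℝ} (hK₁ : 0 < K₁)
    (hK₂ : 0 ≤ K₂) (hK₄ : 0 ≤ K₄) {C₀ : ℕ} (hC₀ : 1 ≤ C₀)
    (hdata : ∀ m n : ℕ, 1 ≤ m → C₀ * m ≤ n → Nonempty (GarbanExplorationData K₁ K₂ K₄ m n)) :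
    Garban2011_fourArm_multiscale :=
  Garban2011_fourArm_multiscale_of_scheme hK₁ hK₂ zero_le_one hK₄ hC₀ fun m n hm hmn =>
    (hdata m n hm hmn).map GarbanExplorationData.toScheme

end Literature.Probability.Percolation
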